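import Mathlib
import Summits.ValiantsHypothesis.ValiantsHypothesis.Theorems.RigidityForcesSymmetryRankRigidMinimalReprLaplaceFourDefs
import Summits.ValiantsHypothesis.ValiantsHypothesis.Theorems.RigidityForcesSymmetryRankRigidMinimalReprLaplaceFourContraction
import Summits.ValiantsHypothesis.ValiantsHypothesis.Theorems.RigidityForcesSymmetryRankRigidMinimalReprLaplaceFourGeneric
import Summits.ValiantsHypothesis.ValiantsHypothesis.Theorems.RigidityForcesSymmetryRankRigidMinimalReprLaplaceFourKernelPlane

/-!
# The profile `(2,2,1)`: typing of the `01|23` left factors (Lemma T)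
# (crux `RankRigidMinimalRepr`, stmt-ValiantsHypothesis-18034, route `RigidityForcesSymmetry`)

For a decomposition `P₄ = Σ_{t<2} g_t(v₀,v₁)h_t(v₂,v₃) + Σ_{k<2} b_k(v₀,v₂)b′_k(v₁,v₃) + c(v₀,v₃)c′(v₁,v₂)`:
`kernel_plane_type` gives, for every `φ ∈ (ℂˣ)⁴`, canonical `x, y` with `x∘φ, y∘φ ⊥ g_tφ`.  These orthogonality
relations are polynomial in `φ`; the COVERING LEMMA makes the type uniform in `φ`, and evaluating the resulting
polynomial identities at `0/1`-vectors yields LEMMA T (`typing_G`): either two rows of both `g_t` vanish («BLOCK») or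
both `g_t ∈ span{A_{ab}, E^{cd}}` for one labelling `{a,b,c,d}` of the letters («EA»).  (Type I planes give BLOCK.)

HONEST FRAMING: a step toward `LaplaceOptimal 4` (rung `TiedTorusBound 3`); the crux stays OPEN; nothing on `VP ≠ VNP`.
-/

set_option autoImplicit false

-- the mandated summit-side namespace repeats a component by design (single-problem summit)
set_option linter.dupNamespace false

namespace Summit.ValiantsHypothesis.ValiantsHypothesis.Theorems.RigidityForcesSymmetryRankRigidMinimalRepr

namespace LaplaceFourLine

open Matrix LaplaceFourContraction LaplaceFourGeneric

/-! ### §1 Extraction of entries from the orthogonality identities -/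

/-- `e_c∘φ ⊥ gφ` for all `φ` forces row `c` of `g` to vanish. -/
theorem row_zero_of_single (g : Fin 4 → Fin 4 → ℂ) (c : Fin 4)
    (H : ∀ φ : Fin 4 → ℂ, (∑ i, ∑ j, ((Pi.single c (1 : ℂ) : Fin 4 → ℂ) i * φ i) * φ j * g i j) = 0) :
    ∀ j, g c j = 0 := by
  intro j
  have h1 := H (Pi.single c 1)
  have h2 := H (Pi.single c 1 + Pi.single j 1)
  fin_cases c <;> fin_cases j <;> simp [Fin.sum_univ_four, Pi.single_apply] at h1 h2 ⊢ <;>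
    first | (linear_combination h1) | (linear_combination h2 - h1)

/-- `(e_a + e_b)∘φ ⊥ gφ` for all `φ`: the rows `a, b` of `g` live on the `2 × 2` block with `g_{ab} = -g_{ba}`. -/
theorem block_of_pair_sum (g : Fin 4 → Fin 4 → ℂ) (a b : Fin 4) (hab : a ≠ b)
    (H : ∀ φ : Fin 4 → ℂ, (∑ i, ∑ j, ((Pi.single a (1 : ℂ) + Pi.single b 1 : Fin 4 → ℂ) i * φ i) * φ j * g i j) = 0) :
    g a a = 0 ∧ g b b = 0 ∧ g a b + g b a = 0 ∧ ∀ j, j ≠ a → j ≠ b → g a j = 0 ∧ g b j = 0 := by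
  have h1 := H (Pi.single a 1)
  have h2 := H (Pi.single b 1)
  have h3 := H (Pi.single a 1 + Pi.single b 1)
  refine ⟨?_, ?_, ?_, fun j hja hjb => ?_⟩
  · fin_cases a <;> fin_cases b <;> simp [Pi.single_apply] at hab h1 ⊢ <;> linear_combination h1
  · fin_cases a <;> fin_cases b <;> simp [Pi.single_apply] at hab h2 ⊢ <;> linear_combination h2
  · fin_cases a <;> fin_cases b <;> simp [Fin.sum_univ_four, Pi.single_apply] at hab h1 h2 h3 ⊢ <;>
      linear_combination h3 - h1 - h2
  · have h4 := H (Pi.single a 1 + Pi.single j 1)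
    have h5 := H (Pi.single b 1 + Pi.single j 1)
    fin_cases a <;> fin_cases b <;> fin_cases j <;>
      simp [Fin.sum_univ_four, Pi.single_apply] at hab hja hjb h1 h2 h4 h5 ⊢ <;>
      exact ⟨by linear_combination h4 - h1, by linear_combination h5 - h2⟩

/-- `(e_c - e_d)∘φ ⊥ gφ` for all `φ`: the rows `c, d` of `g` live on the `2 × 2` block with `g_{cd} = g_{dc}`. -/
theorem block_of_pair_diff (g : Fin 4 → Fin 4 → ℂ) (c d : Fin 4) (hcd : c ≠ d)
    (H : ∀ φ : Fin 4 → ℂ, (∑ i, ∑ j, ((Pi.single c (1 : ℂ) - Pi.single d 1 : Fin 4 → ℂ) i * φ i) * φ j * g i j) = 0) :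
    g c c = 0 ∧ g d d = 0 ∧ g c d = g d c ∧ ∀ j, j ≠ c → j ≠ d → g c j = 0 ∧ g d j = 0 := by
  have h1 := H (Pi.single c 1)
  have h2 := H (Pi.single d 1)
  have h3 := H (Pi.single c 1 + Pi.single d 1)
  refine ⟨?_, ?_, ?_, fun j hjc hjd => ?_⟩
  · fin_cases c <;> fin_cases d <;> simp [Pi.single_apply] at hcd h1 ⊢ <;> linear_combination h1
  · fin_cases c <;> fin_cases d <;> simp [Pi.single_apply] at hcd h2 ⊢ <;> linear_combination h2
  · fin_cases c <;> fin_cases d <;> simp [Fin.sum_univ_four, Pi.single_apply] at hcd h1 h2 h3 ⊢ <;>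
      linear_combination h3 - h1 + h2
  · have h4 := H (Pi.single c 1 + Pi.single j 1)
    have h5 := H (Pi.single d 1 + Pi.single j 1)
    fin_cases c <;> fin_cases d <;> fin_cases j <;>
      simp [Fin.sum_univ_four, Pi.single_apply] at hcd hjc hjd h1 h2 h4 h5 ⊢ <;>
      exact ⟨by linear_combination h4 - h1,
        by linear_combination -h5 - h2⟩

/-! ### §2 The covering argument and Lemma T -/

/-- Evaluation of the orthogonality polynomial `Σ_{ij} (x_i g_{ij}) X_i X_j`. -/
theorem eval_orth_poly (x : Fin 4 → ℂ) (g : Fin 4 → Fin 4 → ℂ) (φ : Fin 4 → ℂ) :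
    MvPolynomial.eval φ (∑ i, ∑ j, MvPolynomial.C (x i * g i j) * MvPolynomial.X i * MvPolynomial.X j) =
      ∑ i, ∑ j, (x i * φ i) * φ j * g i j := by
  simp only [map_sum, map_mul, MvPolynomial.eval_C, MvPolynomial.eval_X]
  exact Finset.sum_congr rfl fun i _ => Finset.sum_congr rfl fun j _ => by ring

/-- **Lemma T (typing of `𝒢`).**  For a `(2,2,1)` decomposition of `P₄`, either two rows of both `g₀, g₁` vanish
(«BLOCK»), or there is a labelling `{a,b,c,d}` of the letters with both `g_t ∈ span{A_{ab}, E^{cd}}` («EA»):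
the only non-zero entries are `g_t(a,b) = -g_t(b,a)` and `g_t(c,d) = g_t(d,c)`. -/
theorem typing_G (g h b b' : Fin 2 → Fin 4 → Fin 4 → ℂ) (c c' : Fin 4 → Fin 4 → ℂ)
    (hsum : ∀ v, permPattern₄ v = (∑ t, g t (v 0) (v 1) * h t (v 2) (v 3)) +
      (∑ k, b k (v 0) (v 2) * b' k (v 1) (v 3)) + c (v 0) (v 3) * c' (v 1) (v 2)) :
    (∃ c₀ d₀ : Fin 4, c₀ ≠ d₀ ∧ ∀ t j, g t c₀ j = 0 ∧ g t d₀ j = 0) ∨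
    (∃ a₀ b₀ c₀ d₀ : Fin 4, [a₀, b₀, c₀, d₀].Nodup ∧ ∀ t,
      (g t a₀ a₀ = 0 ∧ g t b₀ b₀ = 0 ∧ g t a₀ b₀ + g t b₀ a₀ = 0 ∧
        ∀ j, j ≠ a₀ → j ≠ b₀ → g t a₀ j = 0 ∧ g t b₀ j = 0) ∧
      (g t c₀ c₀ = 0 ∧ g t d₀ d₀ = 0 ∧ g t c₀ d₀ = g t d₀ c₀ ∧
        ∀ j, j ≠ c₀ → j ≠ d₀ → g t c₀ j = 0 ∧ g t d₀ j = 0)) := by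
  classical
  -- the canonical vectors, indexed by the three families of planes
  let vec : {cd : Fin 4 × Fin 4 // cd.1 ≠ cd.2} ⊕
      ({v : Fin 4 × Fin 4 × Fin 4 × Fin 4 // [v.1, v.2.1, v.2.2.1, v.2.2.2].Nodup} ⊕
       {v : Fin 4 × Fin 4 × Fin 4 × Fin 4 // [v.1, v.2.1, v.2.2.1, v.2.2.2].Nodup}) → Fin 2 → (Fin 4 → ℂ) :=
    fun σ m => match σ with
    | Sum.inl cd => if m = 0 then Pi.single cd.1.1 1 else Pi.single cd.1.2 1
    | Sum.inr (Sum.inl v) => if m = 0 then Pi.single v.1.1 1 + Pi.single v.1.2.1 1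
        else Pi.single v.1.2.2.1 1 - Pi.single v.1.2.2.2 1
    | Sum.inr (Sum.inr v) => if m = 0 then Pi.single v.1.2.1 1 - Pi.single v.1.2.2.2 1
        else Pi.single v.1.2.2.1 1 - Pi.single v.1.2.2.2 1
  let p := fun σ (k : Fin 2 × Fin 2) =>
    ∑ i, ∑ j, MvPolynomial.C (vec σ k.1 i * g k.2 i j) * MvPolynomial.X i * MvPolynomial.X j
  have hcov : ∀ φ : Fin 4 → ℂ, (∀ i, φ i ≠ 0) → ∃ σ, ∀ k, MvPolynomial.eval φ (p σ k) = 0 := by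
    intro φ hφ
    obtain ⟨x, y, hx, hy, hcanon⟩ := kernel_plane_type g h b b' c c' hsum φ hφ
    rcases hcanon with ⟨c₀, d₀, hcd, rfl, rfl⟩ | ⟨a₀, b₀, c₀, d₀, hnd, rfl, rfl⟩ | ⟨a₀, b₀, c₀, d₀, hnd, rfl, rfl⟩
    · refine ⟨Sum.inl ⟨(c₀, d₀), hcd⟩, fun k => ?_⟩
      obtain ⟨m, t⟩ := k
      simp only [p, eval_orth_poly]
      fin_cases m
      · exact hx t
      · exact hy t
    · refine ⟨Sum.inr (Sum.inl ⟨(a₀, b₀, c₀, d₀), hnd⟩), fun k => ?_⟩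
      obtain ⟨m, t⟩ := k
      simp only [p, eval_orth_poly]
      fin_cases m
      · exact hx t
      · exact hy t
    · refine ⟨Sum.inr (Sum.inr ⟨(a₀, b₀, c₀, d₀), hnd⟩), fun k => ?_⟩
      obtain ⟨m, t⟩ := k
      simp only [p, eval_orth_poly]
      fin_cases m
      · exact hx t
      · exact hy t
  obtain ⟨σ, hσ⟩ := covering p hcov
  have hid : ∀ (m t : Fin 2) (φ : Fin 4 → ℂ), (∑ i, ∑ j, (vec σ m i * φ i) * φ j * g t i j) = 0 := by
    intro m t φ
    have := congrArg (MvPolynomial.eval φ) (hσ (m, t))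
    rwa [map_zero, eval_orth_poly] at this
  rcases σ with ⟨⟨c₀, d₀⟩, hcd⟩ | ⟨⟨a₀, b₀, c₀, d₀⟩, hnd⟩ | ⟨⟨a₀, b₀, c₀, d₀⟩, hnd⟩
  · -- type III: BLOCK
    left
    exact ⟨c₀, d₀, hcd, fun t j =>
      ⟨row_zero_of_single (g t) c₀ (hid 0 t) j, row_zero_of_single (g t) d₀ (hid 1 t) j⟩⟩
  · -- type II: EA
    right
    have h' := hnd
    simp only [List.nodup_cons, List.mem_cons, not_or, List.not_mem_nil, List.nodup_nil, not_false_eq_true,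
      and_true] at h'
    obtain ⟨⟨hab, -, -⟩, ⟨-, -⟩, hcd⟩ := h'
    exact ⟨a₀, b₀, c₀, d₀, hnd, fun t =>
      ⟨block_of_pair_sum (g t) a₀ b₀ hab (hid 0 t), block_of_pair_diff (g t) c₀ d₀ hcd (hid 1 t)⟩⟩
  · -- type I: rows `b₀, c₀, d₀` vanish; in particular BLOCK at `(b₀, c₀)`
    left
    have h' := hnd
    simp only [List.nodup_cons, List.mem_cons, not_or, List.not_mem_nil, List.nodup_nil, not_false_eq_true,
      and_true] at h'
    obtain ⟨⟨-, -, -⟩, ⟨hbc, hbd⟩, hcd⟩ := h'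
    refine ⟨b₀, c₀, hbc, fun t j => ?_⟩
    obtain ⟨hbb, hdd, hbdsym, hrest⟩ := block_of_pair_diff (g t) b₀ d₀ hbd (hid 0 t)
    obtain ⟨hcc, -, hcdsym, hrest'⟩ := block_of_pair_diff (g t) c₀ d₀ hcd (hid 1 t)
    have hdb : g t d₀ b₀ = 0 := (hrest' b₀ hbc (Ne.symm hbd |> fun h => fun e => h e.symm)).2
    have hdc : g t d₀ c₀ = 0 := (hrest c₀ (Ne.symm hbc) hcd).2
    constructor
    · by_cases hj1 : j = b₀
      · rw [hj1]; exact hbb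
      by_cases hj2 : j = d₀
      · rw [hj2, hbdsym]; exact hdb
      exact (hrest j hj1 hj2).1
    · by_cases hj1 : j = c₀
      · rw [hj1]; exact hcc
      by_cases hj2 : j = d₀
      · rw [hj2, hcdsym]; exact hdc
      exact (hrest' j hj1 hj2).1

end LaplaceFourLine

end Summit.ValiantsHypothesis.ValiantsHypothesis.Theorems.RigidityForcesSymmetryRankRigidMinimalRepr
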